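import Literature.NumberTheory.EllipticCurves.HeegnerPointsGenusHalfTraceProofs
import Literature.NumberTheory.EllipticCurves.HeegnerPointsShimuraReduction
import Literature.NumberTheory.ComplexMultiplication.CMLatticeOrderOfDiscriminant
import Literature.NumberTheory.EllipticCurves.RingClassFieldDegree
import HarnessLib

/-!
# `Aut(ℂ/K)` acts on the singular moduli of discriminant `d_K` through TRANSLATIONS of the class group
# (Hasse's `η`, class-field-theory-free; Cox §10.C (10.26), §11.A Thm. 11.2; Gross 1984 §I.1, §4 (4.2))

Topic `NumberTheory/EllipticCurves`. Cell `bsd-goldfeld`, typer seat `bsd-goldfeld-ty` (gen 13), first of the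
two files discharging the named fact `heegnerPoints_shimuraReciprocity`
(`HeegnerPointsShimuraReciprocity.lean`; ROADMAP (R1)–(R2) of the cell memo `TY-HYPOTHESES-AT-TWO.md` §14.6).

## What is proved

Let `D < 0`, `D ≡ 0, 1 (mod 4)`, `𝒪_D = ℤ[ω]` the tree's quadratic order (`OrderCl.QO Δ`, `Δ = ⟨D, _⟩`) with
class group `Cl(𝒪_D)` and Cox's class map `f ↦ [𝔞_f]` (`OrderCl.classOf'`, Thm. 7.7).

* §1 `classJ Δ : Cl(𝒪_D) → ℂ`, **the singular modulus of a class** — `classJ [𝔞_f] = j(τ_f)` for every primitive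
  positive definite `f` of discriminant `D` (`classJ_classOf'`; well defined by Cox Exercise 11.5 / Thm. 11.2,
  the tree's `formJ_eq_of_properEquiv`); it is INJECTIVE (`classJ_injective`: `kleinJ_eq_kleinJ_iff`,
  `properEquiv_of_isGamma0Equiv_one`), and every `σ ∈ Aut(ℂ)` permutes its values
  (`exists_unique_apply_classJ_eq`: Cox (10.26), the tree's `exists_formJ_eq_ringEquiv_apply`).
* §2 **`j` along a level transport, both halves**: `LevelTransport N σ τ τ'` gives `σ(j(τ)) = j(τ')` AND
  `σ(j(Nτ)) = j(Nτ')` (`LevelTransport.apply_kleinJ_eq_and`); and `Nτ_Q = τ_{(A/N, B, CN)}` for a Heegner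
  form `Q = (A, B, C)` of level `N` (`heegnerTau_divLevel`).
* §3 **THE KEY (Hasse's `η`, CFT-free).** For `K` imaginary quadratic, `Δ = ⟨d_K, _⟩`, and `σ ∈ Aut(ℂ)` fixing
  `√d_K`: if `σ(j(1)) = j(η)` (`1` the principal class) then `σ(j(κ)) = j(η·κ)` for EVERY class `κ`
  (`apply_classJ_eq_classJ_mul`). Proof (the level-`a` bookkeeping of the ROADMAP, needing no class field
  theory and no surjectivity at the auxiliary level): put in `κ` a form `g = (a, b, c)` with `gcd(a, d_K) = 1`
  (Cox Lemma 2.25, `BinQF.exists_properEquiv_isPosPrim_isCoprime_a`); then `g` ITSELF is a Heegner form of level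
  `a` and residue `b`, whose level-`a` partner `(1, b, ac)` (Heegner point `aτ_g`) is principal; the tree's
  transport theorem at level `a` (`exists_levelTransport_of_apply_sqrtDisc_eq`, Gross 1984 §I.1 run through
  `Aut(ℂ)`) yields a level-`a` Heegner form `Q'` of residue `b` with `σ(j(τ_g)) = j(τ_{Q'})` and
  `σ(j(aτ_g)) = j(aτ_{Q'}) = j(τ_{(A'/a, B', C'a)})`; and `[𝔞_{Q'}] = [𝔞_{(A'/a, B', C'a)}]·[𝔫_{Q'}]` with
  `[𝔫_{Q'}] = [𝔞_{(a, B', ·)}] = [𝔞_g] = κ` (`classOf'_eq_mul_levelForm`, `heegnerFormClass_level_eq_of_modEq`).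
  Hence `π_σ(κ) = π_σ(1)·κ`: the permutation of `Cl(𝒪_K)` induced by `σ` IS translation by `η_σ := π_σ(1)` —
  the content of Gross 1984 (4.2) `σ_𝔟(𝒪, 𝔫, [𝔞]) = (𝒪, 𝔫, [𝔞𝔟⁻¹])` / Darmon 2004 Thm. 3.7 modulo the NAME of
  `𝔟` (the Artin symbol), which the fact `heegnerPoints_shimuraReciprocity` does not assert.

No named fact is introduced (D-0026): one definition with body (`classJ`) and theorems. The sequel
`HeegnerPointsShimuraReciprocityHoldsProofs.lean` turns §3 into the isomorphism
`Gal(H_K/K) ≃* Cl(𝒪_{d_K})` and discharges the fact.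

## References

* [Cox2013] D. A. Cox, *Primes of the form x² + ny²*, 2nd ed. (2013): §2.C Lemma 2.25; §7.B Thm. 7.7; §10.C
  (10.26); §11.A Thm. 11.1, Thm. 11.2, Exercise 11.5 (held `book:cox2013-primes-form-i-x-sup-2-sup`).
* [Gross1984] B. H. Gross, *Heegner points on `X₀(N)`* (1984), §I.1 and §4 (4.2) (not held; through Darmon 2004).
* [Darmon2004] H. Darmon, *Rational Points on Modular Elliptic Curves*, CBMS 101 (2004), Thm. 3.7 (PDF p. 44).
* [GrossZagier1986] B. Gross, D. Zagier, *Heegner points and derivatives of `L`-series*, Invent. Math. 84 (1986),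
  II §1 pp. 235–236 (`Gal(H/K) ≅ Cl_K` acts on the `(𝒜, 𝔫)` by multiplication on `𝒜`).
-/

noncomputable section

open scoped Classical MatrixGroups IntermediateField

open Complex UpperHalfPlane CongruenceSubgroup PeriodPair
  Literature.NumberTheory.EllipticCurves.ModularForms
  Literature.NumberTheory.QuadraticFields.BinaryQuadraticForm
  Literature.NumberTheory.QuadraticFields.Quadratic
  Literature.Computability.Cryptography.Hallgren2005
  Literature.Computability.Cryptography.Hallgren2005.OrderCl
  Literature.NumberTheory.ComplexMultiplication.CMTypeLattice

universe u

namespace Literature.NumberTheory.EllipticCurves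

/-! ### §1 The singular modulus `j(κ)` of a class `κ ∈ Cl(𝒪_D)` -/

section ClassJ

variable (Δ : NegDiscr)

/-- **The singular modulus of a class**: `classJ Δ κ = j(τ_f) = j(𝔞_f)` for any primitive positive definite form
`f` of discriminant `D = Δ.D` with `[𝔞_f] = κ` (Cox Thm. 11.1: "`j(𝔞)` … depends only on the class of `𝔞`";
Thm. 7.7 for `C(D) ≅ C(𝒪)`); `0` (junk) if no such form exists, which does not happen for `D ≡ 0, 1 (mod 4)`
(`exists_isReduced_classOf'_eq_of_emod_four`). [cite: Cox2013, §11.A Thm. 11.1 with §7.B Thm. 7.7] -/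
def classJ (κ : ClassGroup (QO Δ)) : ℂ :=
  if h : ∃ f : BinQF, f.IsPosPrim Δ.D ∧ classOf' Δ f = κ then formJ (h.choose.a, h.choose.b, h.choose.c) else 0

variable {Δ}

/-- **`classJ [𝔞_f] = j(τ_f)`**: the singular modulus of a class is that of any form in it — properly equivalent
forms have the same `j` (`formJ_eq_of_properEquiv`; Cox Exercise 11.5 with Thm. 11.2) and forms with the same
class are properly equivalent (`classOf'_eq_classOf'_iff_properEquiv`, Thm. 7.7 (ii)).
[cite: Cox2013, §11.A Thm. 11.2 and Exercise 11.5] -/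
theorem classJ_classOf' {f : BinQF} (hf : f.IsPosPrim Δ.D) : classJ Δ (classOf' Δ f) = formJ (f.a, f.b, f.c) := by
  have h : ∃ g : BinQF, g.IsPosPrim Δ.D ∧ classOf' Δ g = classOf' Δ f := ⟨f, hf, rfl⟩
  rw [classJ, dif_pos h]
  have hg := h.choose_spec
  have hpe : h.choose.ProperEquiv f := (classOf'_eq_classOf'_iff_properEquiv Δ hg.1 hf).mp hg.2
  exact formJ_eq_of_properEquiv hg.1.a_pos (by rw [hg.1.disc_eq]; exact Δ.neg) hpe

/-- `classJ` on the class of a triple `Q = (A, B, C)`. [cite: Cox2013, §11.A Thm. 11.2 and Exercise 11.5] -/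
theorem classJ_classOf'_triple {Q : ℤ × ℤ × ℤ} (hQ : (⟨Q.1, Q.2.1, Q.2.2⟩ : BinQF).IsPosPrim Δ.D) :
    classJ Δ (classOf' Δ ⟨Q.1, Q.2.1, Q.2.2⟩) = formJ Q :=
  classJ_classOf' hQ

/-- Every class carries a primitive positive definite form (`D ≡ 0, 1 (mod 4)`; Cox Thm. 7.7 (ii), the tree's
`exists_isReduced_classOf'_eq_of_emod_four`, reducedness dropped; private helper). [cite: Cox2013, §7.B Thm. 7.7 (ii)] -/
private theorem exists_isPosPrim_classOf'_eq (hD4 : Δ.D % 4 = 0 ∨ Δ.D % 4 = 1) (κ : ClassGroup (QO Δ)) :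
    ∃ f : BinQF, f.IsPosPrim Δ.D ∧ classOf' Δ f = κ := by
  obtain ⟨g, hg, -, hκ⟩ := exists_isReduced_classOf'_eq_of_emod_four Δ hD4 κ
  exact ⟨g, hg, hκ⟩

/-- **Equal singular moduli ⇒ equal classes** (for primitive positive definite forms of discriminant `D`):
`j(τ_f) = j(τ_g)` forces `τ_g = γτ_f`, `γ ∈ SL₂(ℤ)` (`kleinJ_eq_kleinJ_iff`), hence `f ∼ g` properly
(`properEquiv_of_isGamma0Equiv_one`) and `[𝔞_f] = [𝔞_g]` (Cox Thm. 11.2: "the `j(𝔞)` are distinct").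
[cite: Cox2013, §11.A Thm. 11.2] -/
theorem classOf'_eq_of_formJ_eq {f g : BinQF} (hf : f.IsPosPrim Δ.D) (hg : g.IsPosPrim Δ.D)
    (h : formJ (f.a, f.b, f.c) = formJ (g.a, g.b, g.c)) : classOf' Δ f = classOf' Δ g := by
  rw [formJ_def, formJ_def, ← kleinJ_eq_periodPair_j, ← kleinJ_eq_periodPair_j, kleinJ_eq_kleinJ_iff] at h
  obtain ⟨γ, hγ⟩ := h
  have h1 : IsGamma0Equiv 1 (f.a, f.b, f.c) (g.a, g.b, g.c) :=
    ⟨⟨γ, by rw [CongruenceSubgroup.Gamma0_mem]; exact Subsingleton.elim _ _⟩, hγ⟩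
  have hfd : f.b ^ 2 - 4 * f.a * f.c < 0 := by
    have := hf.disc_eq; rw [BinQF.disc] at this; rw [this]; exact Δ.neg
  have hdd : g.b ^ 2 - 4 * g.a * g.c = f.b ^ 2 - 4 * f.a * f.c := by
    have h₁ := hf.disc_eq; have h₂ := hg.disc_eq; rw [BinQF.disc] at h₁ h₂; rw [h₁, h₂]
  have hpe := properEquiv_of_isGamma0Equiv_one (Q := (f.a, f.b, f.c)) (Q' := (g.a, g.b, g.c)) hf.a_pos hfd
    hg.a_pos hdd h1
  exact (classOf'_eq_classOf'_iff_properEquiv Δ hf hg).mpr hpe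

/-- **`classJ` is injective** on `Cl(𝒪_D)` (`D ≡ 0, 1 (mod 4)`): Cox Thm. 11.2 ("the `j(𝔞_i)` are distinct").
[cite: Cox2013, §11.A Thm. 11.2] -/
theorem classJ_injective (hD4 : Δ.D % 4 = 0 ∨ Δ.D % 4 = 1) : Function.Injective (classJ Δ) := by
  intro κ κ' h
  obtain ⟨f, hf, rfl⟩ := exists_isPosPrim_classOf'_eq hD4 κ
  obtain ⟨g, hg, rfl⟩ := exists_isPosPrim_classOf'_eq hD4 κ'
  rw [classJ_classOf' hf, classJ_classOf' hg] at h
  exact classOf'_eq_of_formJ_eq hf hg h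

/-- **`Aut(ℂ)` permutes the singular moduli of discriminant `D`, classwise** (Cox (10.26): `σ(j(𝔞)) = j(L)` with `L`
a proper `𝒪`-ideal; the tree's `exists_formJ_eq_ringEquiv_apply`): for every `σ ∈ Aut(ℂ)` and class `κ` there is
a unique class `κ'` with `σ(j(κ)) = j(κ')`. [cite: Cox2013, §10.C (10.26)] -/
theorem exists_unique_apply_classJ_eq (hD4 : Δ.D % 4 = 0 ∨ Δ.D % 4 = 1) (σ : ℂ ≃+* ℂ) (κ : ClassGroup (QO Δ)) :
    ∃! κ' : ClassGroup (QO Δ), σ (classJ Δ κ) = classJ Δ κ' := by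
  obtain ⟨f, hf, rfl⟩ := exists_isPosPrim_classOf'_eq hD4 κ
  have hfd : discr (f.a, f.b, f.c) < 0 := by
    have := hf.disc_eq; rw [BinQF.disc] at this; rw [discr, this]; exact Δ.neg
  obtain ⟨Q', hA', hprim', hdisc', hσ⟩ :=
    exists_formJ_eq_ringEquiv_apply (Q := (f.a, f.b, f.c)) hf.a_pos
      ((isPrimitive_iff_binQF _).mpr hf.primitive) hfd σ
  have hQ' : (⟨Q'.1, Q'.2.1, Q'.2.2⟩ : BinQF).IsPosPrim Δ.D := by
    refine ⟨?_, hA', (isPrimitive_iff_binQF Q').mp hprim'⟩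
    have := hf.disc_eq; rw [BinQF.disc] at this ⊢
    rw [discr, discr] at hdisc'
    rw [hdisc', this]
  refine ⟨classOf' Δ ⟨Q'.1, Q'.2.1, Q'.2.2⟩, ?_, fun κ'' hκ'' ↦ ?_⟩
  · beta_reduce
    rw [classJ_classOf' hf, classJ_classOf'_triple hQ']; exact hσ
  · beta_reduce at hκ''
    obtain ⟨g, hg, rfl⟩ := exists_isPosPrim_classOf'_eq hD4 κ''
    rw [classJ_classOf' hf, classJ_classOf' hg] at hκ''
    exact classOf'_eq_of_formJ_eq hg hQ' (hκ''.symm.trans hσ)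

end ClassJ

/-! ### §2 `j` along a level transport (both halves), and the Heegner point `Nτ_Q` -/

section LevelJ

variable {N : ℕ} [NeZero N]

/-- **`j` along a level-`N` transport, both halves**: if `σ` carries the level-`N` structure of `τ` to that of
`τ'` (`LevelTransport N σ τ τ'`: `Λ_τ^σ = cΛ_{τ'}` and `Λ_{Nτ}^σ = cΛ_{Nτ'}`), then `σ(j(τ)) = j(τ')` and
`σ(j(Nτ)) = j(Nτ')` (`j(Λ^σ) = σ(j(Λ))`, `IsTransportedBy.j_eq`; the first half is also the tree's
`LevelTransport.kleinJ_eq` of `HeckeNeighbourTransport.lean`, not imported here). [cite: DiamondShurman2005, Thm. 1.5.1] -/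
theorem LevelTransport.apply_kleinJ_eq_and {σ : ℂ ≃+* ℂ} {τ τ' : ℍ} (h : LevelTransport N σ τ τ') :
    σ (kleinJ τ) = kleinJ τ' ∧ σ (kleinJ (levelPoint N τ)) = kleinJ (levelPoint N τ') := by
  obtain ⟨M, hM⟩ := exists_isTransportedBy σ (ofUpperHalfPlane τ)
  obtain ⟨M_N, hMN⟩ := exists_isTransportedBy σ (ofUpperHalfPlane (levelPoint N τ))
  obtain ⟨c, hc, hMeq, hMNeq⟩ := h.exists_lattice_eq hM hMN
  refine ⟨?_, ?_⟩
  · rw [kleinJ_eq_periodPair_j, kleinJ_eq_periodPair_j, ← hM.j_eq, j_eq_of_lattice_eq hMeq, j_mulLeft]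
  · rw [kleinJ_eq_periodPair_j, kleinJ_eq_periodPair_j, ← hMN.j_eq, j_eq_of_lattice_eq hMNeq, j_mulLeft]

/-- **`Nτ_Q = τ_{(A/N, B, CN)}`** for a Heegner form `Q = (A, B, C)` of level `N` (`N ∣ A`) and discriminant
`D < 0`: `√D = 2Aτ_Q + B = 2(A/N)τ' + B` (`sqrtDisc_eq`), so `τ' = Nτ_Q`. (The form `(A/N, B, CN)` is again
primitive positive definite of discriminant `D`; it is the Heegner point `(𝒪, 𝔫, [𝔞𝔫⁻¹])`-side partner of
Gross 1984 §I.1, cf. `classOf'_eq_mul_levelForm`.) [cite: Gross1984, §I.1] -/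
theorem heegnerTau_divLevel {D : ℤ} (hD : D < 0) {Q : ℤ × ℤ × ℤ} (hQ : Q ∈ heegnerForms N D) :
    heegnerTau (Q.1 / N, Q.2.1, Q.2.2 * N) = levelPoint N (heegnerTau Q) := by
  obtain ⟨hdisc, hA, hNA, -⟩ := hQ
  have hN0 : (0 : ℤ) < N := by exact_mod_cast NeZero.pos N
  have hAN : Q.1 / N * N = Q.1 := Int.ediv_mul_cancel hNA
  have hA' : 0 < Q.1 / N := by
    rcases lt_or_ge 0 (Q.1 / N) with h | h
    · exact h
    · nlinarith
  have hdisc' : Q.2.1 ^ 2 - 4 * (Q.1 / N) * (Q.2.2 * N) = D := by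
    rw [← hdisc, show 4 * (Q.1 / N) * (Q.2.2 * N) = 4 * (Q.1 / N * N) * Q.2.2 by ring, hAN]
  have h1 := sqrtDisc_eq (Q := (Q.1 / N, Q.2.1, Q.2.2 * N)) hA' hdisc' hD
  have h2 := sqrtDisc_eq hA hdisc hD
  have hANC : ((Q.1 / N : ℤ) : ℂ) * N = Q.1 := by exact_mod_cast hAN
  have hA'0 : ((Q.1 / N : ℤ) : ℂ) ≠ 0 := by exact_mod_cast hA'.ne'
  apply UpperHalfPlane.ext
  rw [coe_levelPoint]
  have key : 2 * ((Q.1 / N : ℤ) : ℂ) * (heegnerTau (Q.1 / N, Q.2.1, Q.2.2 * N) : ℂ) =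
      2 * ((Q.1 / N : ℤ) : ℂ) * ((N : ℂ) * heegnerTau Q) := by
    have : (2 : ℂ) * Q.1 * heegnerTau Q + Q.2.1 = 2 * ((Q.1 / N : ℤ) : ℂ) * heegnerTau (Q.1 / N, Q.2.1, Q.2.2 * N) + Q.2.1 :=
      h2.symm.trans h1
    rw [← hANC] at this
    linear_combination -this
  exact mul_left_cancel₀ (mul_ne_zero two_ne_zero hA'0) key

end LevelJ

/-! ### §3 THE KEY: over `K`, the permutation of `Cl(𝒪_K)` induced by `σ ∈ Aut(ℂ/K)` is a translation -/

section Key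

variable {K : Type u} [Field K] [NumberField K]

/-- The form `(A/N, B, CN)` (Heegner point `Nτ_Q`) of a Heegner form `Q = (A, B, C)` of level `N` and
discriminant `D < 0` with no prime factor of `N` dividing `D` is primitive positive definite of discriminant `D`
(it is `S` applied to the Fricke image `(CN, −B, A/N)`, `HeegnerForm.fricke_mem_heegnerForms`). [folklore] -/
private theorem isPosPrim_divLevel {N : ℕ} [NeZero N] {D : ℤ} (hD : D < 0)
    (hND : ∀ p : ℕ, p.Prime → p ∣ N → ¬ (p : ℤ) ∣ D) {Q : ℤ × ℤ × ℤ} (hQ : Q ∈ heegnerForms N D) :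
    (⟨Q.1 / N, Q.2.1, Q.2.2 * N⟩ : BinQF).IsPosPrim D := by
  have hfr := HeegnerForm.fricke_mem_heegnerForms hD hND hQ
  have hfr' : (⟨Q.2.2 * N, -Q.2.1, Q.1 / N⟩ : BinQF).IsPosPrim D :=
    ⟨hfr.1, hfr.2.1, (BinQF.isPrimitive_iff _).mpr hfr.2.2.2⟩
  have h := (BinQF.properEquiv_S (⟨Q.2.2 * N, -Q.2.1, Q.1 / N⟩ : BinQF)).isPosPrim hD hfr'
  simpa only [neg_neg] using h

/-- A form with leading coefficient `1` has the trivial class (`𝔞_f = (1, ω − k) = 𝒪_D`). [cite: Cox2013, §7.B Thm. 7.7] -/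
private theorem classOf'_eq_one_of_a_eq_one (Δ : NegDiscr) {f : BinQF} (hf : f.IsPosPrim Δ.D) (ha : f.a = 1) :
    classOf' Δ f = 1 := by
  rw [classOf'_eq_one_iff Δ hf]
  refine ⟨1, one_ne_zero, ?_⟩
  rw [Ideal.span_singleton_one, fIdeal, Ideal.eq_top_iff_one]
  refine Ideal.subset_span (Set.mem_insert_iff.2 (Or.inl ?_))
  rw [ha]; simp

/-- **`classJ 1 = j(τ_P)`**, `P` the principal form (`classOf'_one`). [cite: Cox2013, §7.B Thm. 7.7] -/
theorem classJ_one (Δ : NegDiscr) (hD4 : Δ.D % 4 = 0 ∨ Δ.D % 4 = 1) :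
    classJ Δ 1 = formJ (principalForm Δ.D) := by
  rw [← classOf'_one Δ hD4, classJ_classOf' (FormComposition.isPosPrim_one Δ.neg hD4).1]
  rfl

/-- No prime factor of `a` divides `D` when `gcd(a, D) = 1` (the shape of the level hypotheses of the tree's
Heegner files). [folklore] -/
private theorem not_dvd_of_isCoprime {a : ℕ} {D : ℤ} (h : IsCoprime (a : ℤ) D) :
    ∀ p : ℕ, p.Prime → p ∣ a → ¬ (p : ℤ) ∣ D := by
  intro p hp hpa hpD
  have hu : IsUnit (p : ℤ) := h.isUnit_of_dvd' (Int.natCast_dvd_natCast.mpr hpa) hpD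
  have h1 : p = 1 := by simpa [Int.isUnit_iff_natAbs_eq] using hu
  exact hp.one_lt.ne' h1

/-- **THE KEY — Hasse's `η` without class field theory.** Let `K` be imaginary quadratic, `σ ∈ Aut(ℂ)` with
`σ(√d_K) = √d_K` (i.e. `σ` fixes `K ⊂ ℂ`), and suppose `σ(j(1)) = j(η)` for the principal class `1` and a class
`η ∈ Cl(𝒪_{d_K})` (one exists, `exists_unique_apply_classJ_eq`). Then for EVERY class `κ`:
`σ(j(κ)) = j(η·κ)` — the permutation of `Cl(𝒪_K)` that `σ` induces on singular moduli is TRANSLATION by `η`.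
This is the class-group structure of the Galois action on `j`-invariants printed as Gross 1984 (4.2)
(`σ_𝔟(𝒪, 𝔫, [𝔞]) = (𝒪, 𝔫, [𝔞𝔟⁻¹])`) / Darmon 2004 Thm. 3.7 / Gross–Zagier 1986 II §1 ("`Gal(H/K) ≅ Cl_K` acts
… by multiplication on `𝒜`"), WITHOUT the identification `𝔟 ↔ σ` by the Artin symbol. Proof: the level-`a`
bookkeeping described in the module docstring (Cox Lemma 2.25 puts `g = (a, b, c)` with `gcd(a, d_K) = 1` in
`κ`; `g` is a level-`a` Heegner form of residue `b` whose level-`a` partner `(1, b, ac)` is principal;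
`exists_levelTransport_of_apply_sqrtDisc_eq` at level `a`; both `j`-halves of the transport;
`classOf'_eq_mul_levelForm`; `heegnerFormClass_level_eq_of_modEq`).
[cite: Gross1984, §I.1 and §4 (4.2)] [cite: Darmon2004, Thm. 3.7 (PDF p. 44)] [cite: GrossZagier1986, II §1 (pp. 235–236)] -/
theorem apply_classJ_eq_classJ_mul (hK : IsImaginaryQuadratic K) {σ : ℂ ≃+* ℂ}
    (hσ : σ (sqrtDisc (NumberField.discr K)) = sqrtDisc (NumberField.discr K))
    {η : ClassGroup (QO hK.negDiscr)} (hη : σ (classJ hK.negDiscr 1) = classJ hK.negDiscr η)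
    (κ : ClassGroup (QO hK.negDiscr)) :
    σ (classJ hK.negDiscr κ) = classJ hK.negDiscr (η * κ) := by
  have hD : NumberField.discr K < 0 := hK.discr_neg
  have hD4 : hK.negDiscr.D % 4 = 0 ∨ hK.negDiscr.D % 4 = 1 := discr_emod_four hK.1
  -- a form `g = (a, b, c)` in `κ` with `gcd(a, d_K) = 1` (Cox Lemma 2.25)
  obtain ⟨f, hf, rfl⟩ := exists_isPosPrim_classOf'_eq hD4 κ
  obtain ⟨g, hfg, hg, hcop⟩ := BinQF.exists_properEquiv_isPosPrim_isCoprime_a hK.negDiscr.neg hf (M := NumberField.discr K) hD.ne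
  have hκ : classOf' hK.negDiscr f = classOf' hK.negDiscr g := (classOf'_eq_classOf'_iff_properEquiv hK.negDiscr hf hg).mpr hfg
  rw [hκ]
  have hgdisc : g.b ^ 2 - 4 * g.a * g.c = NumberField.discr K := hg.disc_eq
  have hga : 0 < g.a := hg.a_pos
  -- the level `a`
  obtain ⟨a, ha⟩ : ∃ a : ℕ, (a : ℤ) = g.a := ⟨g.a.toNat, Int.toNat_of_nonneg hga.le⟩
  have ha0 : a ≠ 0 := by rintro rfl; simp at ha; linarith
  haveI : NeZero a := ⟨ha0⟩
  have hND : IsCoprime (a : ℤ) (NumberField.discr K) := by rw [ha]; exact hcop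
  have hNDp := not_dvd_of_isCoprime hND
  -- `g` as a Heegner form `G` of level `a` and residue `b`
  set G : ℤ × ℤ × ℤ := (g.a, g.b, g.c) with hG
  have hGf : G ∈ heegnerForms a (NumberField.discr K) :=
    ⟨hgdisc, hga, ⟨1, by rw [ha, mul_one]⟩, (BinQF.isPrimitive_iff _).mp hg.primitive⟩
  have hβD : (4 * a : ℤ) ∣ g.b ^ 2 - NumberField.discr K := ⟨g.c, by rw [← hgdisc, ha]; ring⟩
  have hGβ : G.2.1 ≡ g.b [ZMOD 2 * a] := Int.ModEq.refl _
  -- transport at level `a`: `σ(j(τ_G)) = j(τ_{Q'})`, `σ(j(aτ_G)) = j(aτ_{Q'})`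
  obtain ⟨Q', hQ', hβ', hT⟩ := exists_levelTransport_of_apply_sqrtDisc_eq hK hND hβD hσ hGf hGβ
  obtain ⟨hj, hja⟩ := hT.apply_kleinJ_eq_and
  have hQ'pp : (⟨Q'.1, Q'.2.1, Q'.2.2⟩ : BinQF).IsPosPrim hK.negDiscr.D := ⟨hQ'.1, hQ'.2.1, (BinQF.isPrimitive_iff _).mpr hQ'.2.2.2⟩
  -- (i) `σ(j([g])) = j([Q'])`
  have h1 : σ (classJ hK.negDiscr (classOf' hK.negDiscr g)) = classJ hK.negDiscr (classOf' hK.negDiscr ⟨Q'.1, Q'.2.1, Q'.2.2⟩) := by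
    rw [classJ_classOf' hg, classJ_classOf'_triple hQ'pp, formJ_def, formJ_def, ← kleinJ_eq_periodPair_j,
      ← kleinJ_eq_periodPair_j]
    exact hj
  -- (ii) `σ(j(1)) = j([(A'/a, B', C'a)])`: the level-`a` partners `aτ_G = τ_{(1, b, ca)}` (principal) and `aτ_{Q'}`
  have hG₁pp : (⟨G.1 / a, G.2.1, G.2.2 * a⟩ : BinQF).IsPosPrim hK.negDiscr.D := isPosPrim_divLevel hD hNDp hGf
  have hG₁a : (⟨G.1 / a, G.2.1, G.2.2 * a⟩ : BinQF).a = 1 := by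
    show g.a / (a : ℤ) = 1
    rw [ha]; exact Int.ediv_self hga.ne'
  have hQ₁pp : (⟨Q'.1 / a, Q'.2.1, Q'.2.2 * a⟩ : BinQF).IsPosPrim hK.negDiscr.D := isPosPrim_divLevel hD hNDp hQ'
  have h2 : σ (classJ hK.negDiscr 1) = classJ hK.negDiscr (classOf' hK.negDiscr ⟨Q'.1 / a, Q'.2.1, Q'.2.2 * a⟩) := by
    rw [← classOf'_eq_one_of_a_eq_one hK.negDiscr hG₁pp hG₁a, classJ_classOf' hG₁pp, classJ_classOf' hQ₁pp, formJ_def,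
      formJ_def, ← kleinJ_eq_periodPair_j, ← kleinJ_eq_periodPair_j]
    change σ (kleinJ (heegnerTau (G.1 / a, G.2.1, G.2.2 * a))) = kleinJ (heegnerTau (Q'.1 / a, Q'.2.1, Q'.2.2 * a))
    rw [heegnerTau_divLevel hD hGf, heegnerTau_divLevel hD hQ']
    exact hja
  -- hence `η = [(A'/a, B', C'a)]`
  have hη' : η = classOf' hK.negDiscr ⟨Q'.1 / a, Q'.2.1, Q'.2.2 * a⟩ :=
    classJ_injective hD4 (hη.symm.trans h2)
  -- (iii) `[Q'] = [(A'/a, B', C'a)] · [𝔫_{Q'}]` and `[𝔫_{Q'}] = [𝔫_G] = [g]`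
  have h3 : classOf' hK.negDiscr ⟨Q'.1, Q'.2.1, Q'.2.2⟩ =
      classOf' hK.negDiscr ⟨Q'.1 / a, Q'.2.1, Q'.2.2 * a⟩ * classOf' hK.negDiscr ⟨(a : ℤ), Q'.2.1, Q'.1 / a * Q'.2.2⟩ :=
    classOf'_eq_mul_levelForm hK.negDiscr hNDp hQ'
  have hng : (⟨(a : ℤ), g.b, g.c⟩ : BinQF).IsPosPrim hK.negDiscr.D := by rw [ha]; exact hg
  have h4 : classOf' hK.negDiscr ⟨(a : ℤ), Q'.2.1, Q'.1 / a * Q'.2.2⟩ = classOf' hK.negDiscr g := by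
    have h := heegnerFormClass_level_eq_of_modEq hK (isPosPrim_levelForm hK.negDiscr hNDp hQ') hng hβ'
    rw [heegnerFormClass_def, heegnerFormClass_def] at h
    rw [h, ha]
  -- assemble
  rw [h1, h3, h4, hη']

end Key

/-! ### §4 Hasse's `η : Gal(H_K/K) → Cl(𝒪_{d_K})` is a group ISOMORPHISM (CFT-free) -/

section Eta

variable {K : Type u} [Field K] [NumberField K]

/-- **Every `j(κ)`, `κ ∈ Cl(𝒪_{d_K})`, lies in the field of singular moduli `H_K`** (`formJ_mem_singularModuliField`:
the tree's `isRoot_classPolynomial_holds`). [cite: Cox2013, §13.A Prop. 13.2 (consequence)] -/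
theorem classJ_mem_singularModuliField (hK : IsImaginaryQuadratic K) (ι : K →+* ℂ)
    (κ : ClassGroup (QO hK.negDiscr)) : classJ hK.negDiscr κ ∈ singularModuliField K ι := by
  obtain ⟨f, hf, rfl⟩ := exists_isPosPrim_classOf'_eq (discr_emod_four hK.1) κ
  rw [classJ_classOf' hf]
  exact formJ_mem_singularModuliField ι (Q := (f.a, f.b, f.c)) hf.a_pos
    ((isPrimitive_iff_binQF _).mpr hf.primitive) hf.disc_eq hK.discr_neg

/-- **`Gal(H_K/K)` permutes the classes through `j`**: for `s ∈ Gal(H_K/K)` and a class `κ` there is a unique class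
`κ'` with `s(j(κ)) = j(κ')` (extend `s` to `Aut(ℂ)`, `exists_ringEquiv_restrict_eq`, and use Cox (10.26),
`exists_unique_apply_classJ_eq`). [cite: Cox2013, §10.C (10.26)] -/
theorem exists_unique_galois_apply_classJ_eq (hK : IsImaginaryQuadratic K) (ι : K →+* ℂ)
    (s : singularModuliField K ι ≃ₐ[K] singularModuliField K ι) (κ : ClassGroup (QO hK.negDiscr)) :
    ∃! κ' : ClassGroup (QO hK.negDiscr),
      ((s ⟨classJ hK.negDiscr κ, classJ_mem_singularModuliField hK ι κ⟩ : singularModuliField K ι) : ℂ) =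
        classJ hK.negDiscr κ' := by
  obtain ⟨σ, hσF, -⟩ := exists_ringEquiv_restrict_eq hK ι s
  rw [← hσF]
  exact exists_unique_apply_classJ_eq (discr_emod_four hK.1) σ κ

/-- **Hasse's `η(s) ∈ Cl(𝒪_{d_K})`** for `s ∈ Gal(H_K/K)`: THE class with `s(j(𝒪_K)) = j(η(s))` (Cox §13 /
Darmon 2004 Thm. 3.3: under the Artin isomorphism `rec : Pic(𝒪) → Gal(H/K)` this is `rec⁻¹(s)⁻¹`, Gross 1984
(4.2); defined here by the action on the singular modulus of the principal class, no class field theory).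
[cite: Darmon2004, Thm. 3.3 and Thm. 3.7 (PDF pp. 41–44)] [cite: Gross1984, §4 (4.2)] -/
def galClass (hK : IsImaginaryQuadratic K) (ι : K →+* ℂ)
    (s : singularModuliField K ι ≃ₐ[K] singularModuliField K ι) : ClassGroup (QO hK.negDiscr) :=
  (exists_unique_galois_apply_classJ_eq hK ι s 1).choose

/-- Defining property of `galClass`: `s(j(1)) = j(η(s))`. [cite: Darmon2004, Thm. 3.7 (PDF p. 44)] -/
theorem galois_apply_classJ_one (hK : IsImaginaryQuadratic K) (ι : K →+* ℂ)
    (s : singularModuliField K ι ≃ₐ[K] singularModuliField K ι) :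
    ((s ⟨classJ hK.negDiscr 1, classJ_mem_singularModuliField hK ι 1⟩ : singularModuliField K ι) : ℂ) =
      classJ hK.negDiscr (galClass hK ι s) :=
  (exists_unique_galois_apply_classJ_eq hK ι s 1).choose_spec.1

/-- **Shimura reciprocity on singular moduli, class-group form: `s(j(κ)) = j(η(s)·κ)`** for every
`s ∈ Gal(H_K/K)` and every class `κ` (Darmon 2004 Thm. 3.7 at level `1` / Cox Thm. 11.1 / Gross–Zagier 1986
II §1, the translation structure — from §3, `apply_classJ_eq_classJ_mul`, after extending `s` to `Aut(ℂ/K)`).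
[cite: Darmon2004, Thm. 3.7 (PDF p. 44)] [cite: GrossZagier1986, II §1 (pp. 235–236)] -/
theorem galois_apply_classJ (hK : IsImaginaryQuadratic K) (ι : K →+* ℂ)
    (s : singularModuliField K ι ≃ₐ[K] singularModuliField K ι) (κ : ClassGroup (QO hK.negDiscr)) :
    ((s ⟨classJ hK.negDiscr κ, classJ_mem_singularModuliField hK ι κ⟩ : singularModuliField K ι) : ℂ) =
      classJ hK.negDiscr (galClass hK ι s * κ) := by
  obtain ⟨σ, hσF, hσK⟩ := exists_ringEquiv_restrict_eq hK ι s
  have hσD := apply_sqrtDisc_discr_eq hK ι hσK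
  have hη : σ (classJ hK.negDiscr 1) = classJ hK.negDiscr (galClass hK ι s) :=
    (hσF ⟨classJ hK.negDiscr 1, classJ_mem_singularModuliField hK ι 1⟩).trans (galois_apply_classJ_one hK ι s)
  rw [← hσF]
  exact apply_classJ_eq_classJ_mul hK hσD hη κ

/-- An automorphism of `ℂ` agreeing with `s` on `H_K` maps `j(κ)` to `j(η(s)κ)`. [cite: Darmon2004, Thm. 3.7 (PDF p. 44)] -/
theorem ringEquiv_apply_classJ (hK : IsImaginaryQuadratic K) (ι : K →+* ℂ)
    (s : singularModuliField K ι ≃ₐ[K] singularModuliField K ι) {σ : ℂ ≃+* ℂ}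
    (hσF : ∀ x : singularModuliField K ι, σ x = s x) (κ : ClassGroup (QO hK.negDiscr)) :
    σ (classJ hK.negDiscr κ) = classJ hK.negDiscr (galClass hK ι s * κ) := by
  rw [← galois_apply_classJ hK ι s κ]
  exact hσF ⟨classJ hK.negDiscr κ, classJ_mem_singularModuliField hK ι κ⟩

/-- `η(1) = 1` (the identity of `Gal(H_K/K)` fixes `j(𝒪_K)`). [cite: Darmon2004, Thm. 3.3 (PDF p. 41)] -/
theorem galClass_one (hK : IsImaginaryQuadratic K) (ι : K →+* ℂ) :
    galClass hK ι (1 : singularModuliField K ι ≃ₐ[K] singularModuliField K ι) = 1 := by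
  apply classJ_injective (discr_emod_four hK.1)
  rw [← galois_apply_classJ_one hK ι 1]
  rfl

/-- **`η` is a homomorphism**: `η(st) = η(s)η(t)` (`(st)(j(1)) = s(j(η(t))) = j(η(s)η(t))` and `j` is injective on
classes). [cite: Darmon2004, Thm. 3.3 (PDF p. 41)] -/
theorem galClass_mul (hK : IsImaginaryQuadratic K) (ι : K →+* ℂ)
    (s t : singularModuliField K ι ≃ₐ[K] singularModuliField K ι) :
    galClass hK ι (s * t) = galClass hK ι s * galClass hK ι t := by
  apply classJ_injective (discr_emod_four hK.1)
  rw [← galois_apply_classJ_one hK ι (s * t), AlgEquiv.mul_apply]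
  have ht := galois_apply_classJ_one hK ι t
  have hts : t ⟨classJ hK.negDiscr 1, classJ_mem_singularModuliField hK ι 1⟩ =
      ⟨classJ hK.negDiscr (galClass hK ι t), classJ_mem_singularModuliField hK ι _⟩ := Subtype.ext ht
  rw [hts, galois_apply_classJ hK ι s]

/-- **`η` is injective**: if `η(s) = 1` then `s` fixes every singular modulus `j(κ)` and `K`, hence the field
`H_K = K(j(κ) : κ)` they generate. [cite: Cox2013, §11.A Thm. 11.1] -/
theorem galClass_injective (hK : IsImaginaryQuadratic K) (ι : K →+* ℂ) :
    Function.Injective (galClass hK ι) := by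
  intro s t hst
  -- reduce to `η(t⁻¹ s) = 1 ⇒ t⁻¹ s = 1`
  suffices h : ∀ u : singularModuliField K ι ≃ₐ[K] singularModuliField K ι, galClass hK ι u = 1 → u = 1 by
    have h1 : galClass hK ι (t⁻¹ * s) = 1 := by
      rw [galClass_mul, hst, ← galClass_mul, inv_mul_cancel, galClass_one]
    have := h _ h1
    rw [inv_mul_eq_one] at this
    exact this.symm
  intro u hu
  obtain ⟨σ, hσF, hσK⟩ := exists_ringEquiv_restrict_eq hK ι u
  -- `σ` fixes the generators `ι(K) ∪ singularModuli K` of `H_K`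
  have hgen : Set.EqOn (σ : ℂ →+* ℂ) (RingHom.id ℂ) (Set.range ι ∪ ↑(singularModuli K)) := by
    rintro x (⟨k, rfl⟩ | hx)
    · exact hσK k
    · obtain ⟨Q, hQ, rfl⟩ := Finset.mem_image.mp (Finset.mem_coe.mp hx)
      obtain ⟨hd, hA, hprim, -⟩ := (mem_reducedForms_iff hK.discr_neg).mp hQ
      have hQpp : (⟨Q.1, Q.2.1, Q.2.2⟩ : BinQF).IsPosPrim hK.negDiscr.D :=
        ⟨hd, hA, (isPrimitive_iff_binQF Q).mp hprim⟩
      change σ (formJ Q) = formJ Q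
      rw [← classJ_classOf'_triple hQpp, ringEquiv_apply_classJ hK ι u hσF, hu, one_mul]
  have hfix : Set.EqOn (σ : ℂ →+* ℂ) (RingHom.id ℂ) (singularModuliField K ι) :=
    RingHom.eqOn_field_closure hgen
  apply AlgEquiv.ext
  intro x
  apply Subtype.ext
  rw [← hσF x]
  exact hfix x.2

/-- **`η` is bijective**: injective, and `#Cl(𝒪_{d_K}) = h(d_K) = [K(j(𝒪_K)) : K] ≤ [H_K : K] = #Gal(H_K/K)`
(`natCard_classGroup_QO_of_emod_four`, `finrank_adjoin_formJ_principalForm_eq_classNumber`, `H_K/K` Galois by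
`finiteDimensional_and_isGalois_singularModuliField` with `irreducible_classPolynomial_holds`). By Cox Thm. 11.1
(`H_K = K(j(𝒪_K))`) equality holds throughout; only the inequality is needed.
[cite: Cox2013, §11.A Thm. 11.1 and §13.A Prop. 13.2] [cite: Darmon2004, Thm. 3.3 (PDF p. 41)] -/
theorem galClass_bijective (hK : IsImaginaryQuadratic K) (ι : K →+* ℂ) :
    Function.Bijective (galClass hK ι) := by
  letI : Algebra K ℂ := ι.toAlgebra
  have hD : NumberField.discr K < 0 := hK.discr_neg
  have hD4 := discr_emod_four hK.1
  haveI : Finite (ClassGroup (QO hK.negDiscr)) := finite_classGroup_QO_of_emod_four hK.negDiscr hD4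
  obtain ⟨hfd, hgal⟩ := finiteDimensional_and_isGalois_singularModuliField irreducible_classPolynomial_holds hK ι
  haveI := hfd
  haveI := hgal
  refine (galClass_injective hK ι).bijective_of_nat_card_le ?_
  rw [natCard_classGroup_QO_of_emod_four hK.negDiscr hD4, IsGalois.card_aut_eq_finrank]
  -- `h(d_K) = [K(j₀) : K] ≤ [H_K : K]`
  set j₀ : ℂ := formJ (principalForm (NumberField.discr K)) with hj₀
  have hle : (K⟮j₀⟯).toSubfield ≤ singularModuliField K ι := by
    rw [IntermediateField.adjoin_toSubfield, Subfield.closure_le]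
    rintro x (⟨k, rfl⟩ | hx)
    · exact apply_mem_singularModuliField ι k
    · rw [Set.mem_singleton_iff] at hx
      rw [hx]
      exact formJ_mem_singularModuliField_of_mem_reducedForms ι (principalForm_mem_reducedForms hD hD4)
  let f : K⟮j₀⟯ →ₗ[K] singularModuliField K ι :=
    { toFun := fun x ↦ ⟨(x : ℂ), hle x.2⟩
      map_add' := fun _ _ ↦ rfl
      map_smul' := fun _ _ ↦ rfl }
  have hf : Function.Injective f := by
    intro x y h
    exact Subtype.ext (congrArg (fun z : singularModuliField K ι ↦ (z : ℂ)) h)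
  calc classNumber hK.negDiscr.D = Module.finrank K K⟮j₀⟯ :=
        (finrank_adjoin_formJ_principalForm_eq_classNumber hK hD hD4).symm
    _ ≤ Module.finrank K (singularModuliField K ι) := LinearMap.finrank_le_finrank_of_injective hf

/-- **Hasse's isomorphism `η : Gal(H_K/K) ≃* Cl(𝒪_{d_K})`, `η(s)` defined by `s(j(1)) = j(η(s))`, with
`s(j(κ)) = j(η(s)κ)` for all `κ`** (`galois_apply_classJ`) — the Artin isomorphism of Darmon 2004 Thm. 3.3 /
Cox Thm. 11.1 for the maximal order, up to the inversion convention, obtained WITHOUT class field theory from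
the `Aut(ℂ)`-transport of level structures (Gross 1984 §I.1) at auxiliary levels.
[cite: Darmon2004, Thm. 3.3 and Thm. 3.7 (PDF pp. 41–44)] [cite: Cox2013, §11.A Thm. 11.1] -/
def galClassEquiv (hK : IsImaginaryQuadratic K) (ι : K →+* ℂ) :
    (singularModuliField K ι ≃ₐ[K] singularModuliField K ι) ≃* ClassGroup (QO hK.negDiscr) :=
  MulEquiv.ofBijective (MonoidHom.mk' (galClass hK ι) (galClass_mul hK ι)) (galClass_bijective hK ι)

/-- `galClassEquiv s = galClass s` (unfolding). [cite: Darmon2004, Thm. 3.3 (PDF p. 41)] -/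
theorem galClassEquiv_apply (hK : IsImaginaryQuadratic K) (ι : K →+* ℂ)
    (s : singularModuliField K ι ≃ₐ[K] singularModuliField K ι) : galClassEquiv hK ι s = galClass hK ι s := rfl

/-- `η(θ(γ)) = γ` for `θ = η⁻¹` (unfolding). [cite: Darmon2004, Thm. 3.3 (PDF p. 41)] -/
theorem galClass_galClassEquiv_symm (hK : IsImaginaryQuadratic K) (ι : K →+* ℂ)
    (γ : ClassGroup (QO hK.negDiscr)) : galClass hK ι ((galClassEquiv hK ι).symm γ) = γ := by
  rw [← galClassEquiv_apply, MulEquiv.apply_symm_apply]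

/-- **The translation law for `θ = η⁻¹`**: `θ(γ)` maps `j(κ)` to `j(γκ)`. [cite: Darmon2004, Thm. 3.7 (PDF p. 44)] -/
theorem galClassEquiv_symm_apply_classJ (hK : IsImaginaryQuadratic K) (ι : K →+* ℂ)
    (γ κ : ClassGroup (QO hK.negDiscr)) :
    (((galClassEquiv hK ι).symm γ ⟨classJ hK.negDiscr κ, classJ_mem_singularModuliField hK ι κ⟩ :
        singularModuliField K ι) : ℂ) = classJ hK.negDiscr (γ * κ) := by
  rw [galois_apply_classJ hK ι, galClass_galClassEquiv_symm]

/-- **Degree and order**: `#Gal(H_K/K) = #Cl(𝒪_{d_K}) = h(d_K)` (Cox Thm. 11.1 / Cor. 11.34 for `H_K ⊂ ℂ`, proved).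
[cite: Cox2013, §11.A Thm. 11.1 and Cor. 11.34] -/
theorem natCard_gal_singularModuliField (hK : IsImaginaryQuadratic K) (ι : K →+* ℂ) :
    Nat.card (singularModuliField K ι ≃ₐ[K] singularModuliField K ι) = classNumber (NumberField.discr K) := by
  rw [Nat.card_congr (galClassEquiv hK ι).toEquiv, natCard_classGroup_QO_of_emod_four hK.negDiscr (discr_emod_four hK.1)]
  rfl

end Eta

end Literature.NumberTheory.EllipticCurves

end
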